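import Summits.MatrixMultiplication.OmegaCensus.SmallFormats.DualPlaneRankLowerBound
import Summits.MatrixMultiplication.OmegaCensus.SmallFormats.RankOneXFormsSumBound
import Literature.Computability.AlgebraicComplexity.SmallFormatRankNormalization
import Literature.Computability.AlgebraicComplexity.MatMulTwoTwoNRankUpper
import Mathlib.Algebra.Field.ZMod
import HarnessLib

/-!
# ω-census family (a): `R_𝔽₂(⟨2,2,n⟩) = ⌈7n/2⌉` for every `n` (Hopcroft–Kerr 1971), by plane-cap counting

Cell `pub-omega` (unit `pub-omega-tensor-g5`), topic `Summits/MatrixMultiplication/OmegaCensus`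
(sub-folder `SmallFormats`). Framing (verbatim): lottery ticket; floor = certified bounds/negative ranges.
HONEST FRAMING: a kernel re-derivation of a PUBLISHED theorem — Hopcroft–Kerr 1971 (bib `HopcroftKerr1971`,
SIAM J. Appl. Math. 20: `⌈7n/2⌉` multiplications are necessary and sufficient for `2×2` by `2×n` over `GF(2)`;
re-proved for all finite fields' `q = 2` case by Alekseev–Nazarov 2019) — by a short counting argument assembled
from two census lemmas already in the tree (the proof route is ours; the VALUE is the printed one). What is new
for the census: the value `R_𝔽₂(⟨2,2,n⟩)` is a KERNEL theorem for every `n` at once (cells `⟨2,2,2..4⟩` re-derive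
the landed certificate values 7/11/14; `R_𝔽₂(⟨2,2,5⟩) = 18` and all larger `n` are new kernel values). Nothing
here is progress on `ω`.

THE ARGUMENT. Let `⟨2,2,n⟩ = ∑_{i<r} w_i ⊗ u_i ⊗ v_i` over `𝔽₂`, `u_i ∈ M₂(𝔽₂)` the X-coefficient matrices.
* (S) `∑_i rank u_i ≥ 4n` (`RankOneXForms.kmn_le_sum_rankBound_X`, any field).
* (J) For each of the 9 planes `D ⊂ M₂(𝔽₂)` sandwich-equivalent to the dual-number plane `span(I, E₀₁)`
  ("J-planes"), the products whose `u_i` annihilates `D` drop out when `X` is restricted to `D`, and what is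
  left computes `X ↦ XY` on `D`, which needs `≥ 3n` products (`SmallFormats.three_mul_le_card`, ENG2's module
  lemma, any field): `3n + #{i : u_i ⊥ D} ≤ r`.
* (I) Over `𝔽₂` every rank-one matrix annihilates exactly one J-plane and every invertible matrix exactly three
  (a `decide`). Summing (J) over the 9 planes: `27n + #{rank 1} + 3·#{rank 2} ≤ 9r`; with (S)
  `#{rank 1} + 2·#{rank 2} ≥ 4n` and `#{rank 1} + #{rank 2} ≤ r` this gives `7n ≤ 2r`.
With the tree's Hopcroft–Kerr gluing `R(⟨2,2,n⟩) ≤ ⌈7n/2⌉` the value is exact.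
-/

namespace Summit.MatrixMultiplication.OmegaCensus.SmallFormats

open Module Matrix Literature.Computability.AlgebraicComplexity

/-! ## The cap of one J-plane (any field) -/

section Cap

variable {k : Type*} [Field k]

/-- The X-form with coefficient matrix `A`: `x ↦ ∑_b A_b x_b` (the first forms of `bilinCompOfTriads`). -/
def dotX (A : Fin 2 × Fin 2 → k) (x : Matrix (Fin 2) (Fin 2) k) : k := ∑ b : Fin 2 × Fin 2, A b * x b.1 b.2

/-- `dotX` written out. -/
theorem dotX_eq (A : Fin 2 × Fin 2 → k) (x : Matrix (Fin 2) (Fin 2) k) :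
    dotX A x = A (0, 0) * x 0 0 + A (0, 1) * x 0 1 + A (1, 0) * x 1 0 + A (1, 1) * x 1 1 := by
  rw [dotX, Fintype.sum_prod_type]
  simp [Fin.sum_univ_two]
  ring

/-- The matrix unit `E₀₁`. -/
def E01 : Matrix (Fin 2) (Fin 2) k := Matrix.of ![![0, 1], ![0, 0]]

/-- `E₀₁ Y = N Y` (row 1 of `Y` moved to row 0). -/
theorem E01_mul {n : ℕ} (Y : Matrix (Fin 2) (Fin n) k) :
    (E01 * Y : Matrix (Fin 2) (Fin n) k) = dualShift n Y := by
  funext i j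
  rw [Matrix.mul_apply, Fin.sum_univ_two]
  fin_cases i <;> simp [E01]

/-- Witness data for a plane `span(M, N) ⊂ M₂(k)` sandwich-equivalent to the dual-number plane:
`P' M Q' = I` and `P' N Q' = E₀₁`. -/
structure JPlane (k : Type*) [Field k] where
  /-- first generator (goes to `I`) -/
  M : Matrix (Fin 2) (Fin 2) k
  /-- second generator (goes to `E₀₁`) -/
  N : Matrix (Fin 2) (Fin 2) k
  /-- left un-sandwich -/
  P' : Matrix (Fin 2) (Fin 2) k
  /-- right un-sandwich -/
  Q' : Matrix (Fin 2) (Fin 2) k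
  hM : P' * M * Q' = 1
  hN : P' * N * Q' = E01

variable (D : JPlane k)

/-- The plane `span(M, N)`. -/
def JPlane.sub : Submodule k (Matrix (Fin 2) (Fin 2) k) := Submodule.span k {D.M, D.N}

/-- `s ↦ s₀ M + s₁ N`, into the plane. -/
noncomputable def JPlane.param : (Fin 2 → k) →ₗ[k] D.sub :=
  LinearMap.codRestrict D.sub
    ((LinearMap.proj 0 : (Fin 2 → k) →ₗ[k] k).smulRight D.M + (LinearMap.proj 1 : (Fin 2 → k) →ₗ[k] k).smulRight D.N)
    (fun s => by
      simp only [LinearMap.add_apply, LinearMap.smulRight_apply, LinearMap.proj_apply]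
      exact Submodule.add_mem _ (Submodule.smul_mem _ _ (Submodule.subset_span (by simp)))
        (Submodule.smul_mem _ _ (Submodule.subset_span (by simp))))

/-- The transport identity: `s₀ Y + s₁ N Y = P' ((s₀ M + s₁ N)(Q' Y))`. -/
theorem JPlane.dualPlaneMul_eq (n : ℕ) (s : Fin 2 → k) (Y : Fin 2 → Fin n → k) :
    dualPlaneMul n s Y
      = (mulLeftLin k D.P' : Matrix (Fin 2) (Fin n) k →ₗ[k] Matrix (Fin 2) (Fin n) k)
          (((mulBilin k 2 2 n).comp D.sub.subtype) (D.param s) ((mulLeftLin k D.Q') Y)) := by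
  have hpar : ((D.param s : D.sub) : Matrix (Fin 2) (Fin 2) k) = s 0 • D.M + s 1 • D.N := by
    simp [JPlane.param]
  rw [LinearMap.comp_apply, Submodule.subtype_apply, hpar, mulBilin_apply, mulLeftLin_apply, mulLeftLin_apply]
  set Y' : Matrix (Fin 2) (Fin n) k := Y with hY'
  have h1 : D.P' * ((s 0 • D.M + s 1 • D.N) * (D.Q' * Y')) = s 0 • ((D.P' * D.M * D.Q') * Y') + s 1 • ((D.P' * D.N * D.Q') * Y') := by
    simp only [Matrix.add_mul, Matrix.smul_mul, Matrix.mul_add, Matrix.mul_smul, Matrix.mul_assoc]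
  rw [h1, D.hM, D.hN, Matrix.one_mul, E01_mul]
  rfl

/-- **The cap of a J-plane** (any field): in a bilinear computation of `⟨2,2,n⟩` whose first forms are
`x ↦ dotX (A i) x`, the products with `A i ⊥ span(M, N)` number at most `|ι| − 3n`. -/
theorem JPlane.three_mul_add_card_le {n : ℕ} {ι : Type*} [Fintype ι] [DecidableEq ι]
    (β : BilinComp (mulBilin k 2 2 n) ι) (A : ι → Fin 2 × Fin 2 → k) (hA : ∀ i x, β.f i x = dotX (A i) x)
    (p : ι → Prop) [DecidablePred p] (hp : ∀ i, p i → dotX (A i) D.M = 0 ∧ dotX (A i) D.N = 0) :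
    3 * n + (Finset.univ.filter p).card ≤ Fintype.card ι := by
  classical
  set J := Finset.univ.filter p with hJdef
  have hJ : ∀ i ∈ J, ∀ x ∈ D.sub, β.f i x = 0 := by
    intro i hi x hx
    rw [hJdef, Finset.mem_filter] at hi
    have hi' := hp i hi.2
    have hle : D.sub ≤ LinearMap.ker (β.f i) := by
      rw [JPlane.sub, Submodule.span_le]
      intro y hy
      simp only [Set.mem_insert_iff, Set.mem_singleton_iff] at hy
      rw [SetLike.mem_coe, LinearMap.mem_ker, hA]
      rcases hy with rfl | rfl
      · exact hi'.1
      · exact hi'.2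
    exact hle hx
  obtain ⟨r, hr, ⟨β'⟩⟩ := β.exists_restrict_of_forall_eq_zero D.sub J hJ
  have β'' : BilinComp (dualPlaneMul (k := k) n) (Fin r) :=
    β'.comap D.param (mulLeftLin k D.Q') (mulLeftLin k D.P') (fun s Y => D.dualPlaneMul_eq n s Y)
  have h3 := three_mul_le_card n β''
  rw [Fintype.card_fin] at h3
  have hJle : J.card ≤ Fintype.card ι := Finset.card_le_univ J
  omega

end Cap

/-! ## The nine J-planes of `M₂(𝔽₂)` and the counting -/

section GF2

/-- Coefficient function from four entries. -/
def mk4 {k : Type*} (a b c d : k) : Fin 2 × Fin 2 → k := fun p => (Matrix.of ![![a, b], ![c, d]]) p.1 p.2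

/-- A coefficient function is `mk4` of its entries. -/
theorem eq_mk4 {k : Type*} (A : Fin 2 × Fin 2 → k) : A = mk4 (A (0, 0)) (A (0, 1)) (A (1, 0)) (A (1, 1)) := by
  funext ⟨i, j⟩
  fin_cases i <;> fin_cases j <;> rfl

/-- A statement about all coefficient functions reduces to the four entries. -/
theorem forall_of_forall_mk4 {k : Type*} {P : (Fin 2 × Fin 2 → k) → Prop} (h : ∀ a b c d, P (mk4 a b c d)) :
    ∀ A, P A := fun A => by rw [eq_mk4 A]; exact h _ _ _ _

/-- The generators and un-sandwiches of the nine J-planes of `M₂(𝔽₂)` (`M ↦ I`, `N ↦ E₀₁`). -/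
def jM : Fin 9 → Matrix (Fin 2) (Fin 2) (ZMod 2) := ![
  Matrix.of ![![1, 0], ![0, 1]], Matrix.of ![![1, 1], ![0, 1]], Matrix.of ![![0, 1], ![1, 0]],
  Matrix.of ![![0, 1], ![1, 0]], Matrix.of ![![0, 1], ![1, 1]], Matrix.of ![![1, 0], ![0, 1]],
  Matrix.of ![![0, 1], ![1, 1]], Matrix.of ![![0, 1], ![1, 0]], Matrix.of ![![1, 0], ![1, 1]]]
/-- see `jM` -/
def jN : Fin 9 → Matrix (Fin 2) (Fin 2) (ZMod 2) := ![
  Matrix.of ![![0, 0], ![1, 0]], Matrix.of ![![0, 0], ![1, 1]], Matrix.of ![![0, 0], ![0, 1]],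
  Matrix.of ![![1, 0], ![0, 0]], Matrix.of ![![1, 1], ![0, 0]], Matrix.of ![![0, 1], ![0, 0]],
  Matrix.of ![![1, 0], ![1, 0]], Matrix.of ![![1, 1], ![1, 1]], Matrix.of ![![0, 1], ![0, 1]]]
/-- see `jM` -/
def jP : Fin 9 → Matrix (Fin 2) (Fin 2) (ZMod 2) := ![
  Matrix.of ![![0, 1], ![1, 0]], Matrix.of ![![0, 1], ![1, 0]], Matrix.of ![![0, 1], ![1, 0]],
  Matrix.of ![![1, 0], ![0, 1]], Matrix.of ![![1, 0], ![0, 1]], Matrix.of ![![1, 0], ![0, 1]],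
  Matrix.of ![![1, 0], ![1, 1]], Matrix.of ![![1, 0], ![1, 1]], Matrix.of ![![1, 0], ![1, 1]]]
/-- see `jM` -/
def jQ : Fin 9 → Matrix (Fin 2) (Fin 2) (ZMod 2) := ![
  Matrix.of ![![0, 1], ![1, 0]], Matrix.of ![![1, 1], ![1, 0]], Matrix.of ![![1, 0], ![0, 1]],
  Matrix.of ![![0, 1], ![1, 0]], Matrix.of ![![1, 1], ![1, 0]], Matrix.of ![![1, 0], ![0, 1]],
  Matrix.of ![![0, 1], ![1, 0]], Matrix.of ![![1, 1], ![1, 0]], Matrix.of ![![1, 0], ![0, 1]]]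

/-- The un-sandwiches take `M` to `I` (`decide`). -/
theorem jM_ok : ∀ l : Fin 9, jP l * jM l * jQ l = 1 := by decide
/-- The un-sandwiches take `N` to `E₀₁` (`decide`). -/
theorem jN_ok : ∀ l : Fin 9, jP l * jN l * jQ l = E01 := by decide

/-- The nine J-planes of `M₂(𝔽₂)`. -/
def jPlane (l : Fin 9) : JPlane (ZMod 2) := ⟨jM l, jN l, jP l, jQ l, jM_ok l, jN_ok l⟩

/-- The pairing `⟨A, M⟩ = ∑_b A_b M_b`, written out (computable form of `dotX`). -/
def pdot (A : Fin 2 × Fin 2 → ZMod 2) (M : Matrix (Fin 2) (Fin 2) (ZMod 2)) : ZMod 2 :=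
  A (0, 0) * M 0 0 + A (0, 1) * M 0 1 + A (1, 0) * M 1 0 + A (1, 1) * M 1 1

/-- `dotX = pdot`. -/
theorem dotX_eq_pdot (A : Fin 2 × Fin 2 → ZMod 2) (M : Matrix (Fin 2) (Fin 2) (ZMod 2)) :
    dotX A M = pdot A M := dotX_eq A M

/-- `A` annihilates J-plane `l` (Boolean test). -/
def perp (A : Fin 2 × Fin 2 → ZMod 2) (l : Fin 9) : Bool := decide (pdot A (jM l) = 0 ∧ pdot A (jN l) = 0)

/-- A positive `perp` test gives the two vanishing pairings. -/
theorem perp_dotX {A : Fin 2 × Fin 2 → ZMod 2} {l : Fin 9} (h : perp A l = true) :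
    dotX A (jPlane l).M = 0 ∧ dotX A (jPlane l).N = 0 := by
  rw [dotX_eq_pdot, dotX_eq_pdot]; exact of_decide_eq_true h

/-- `A = 0`, tested on entries. -/
def isZero4 (A : Fin 2 × Fin 2 → ZMod 2) : Bool := decide (A (0, 0) = 0 ∧ A (0, 1) = 0 ∧ A (1, 0) = 0 ∧ A (1, 1) = 0)
/-- `det A = 0` (`⇔ rank A ≤ 1` for a `2×2` matrix), tested on entries. -/
def det0 (A : Fin 2 × Fin 2 → ZMod 2) : Bool := decide (A (0, 0) * A (1, 1) = A (0, 1) * A (1, 0))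

/-- Rank weight of a `2×2` matrix over `𝔽₂`: `0 / 1 / 2`. -/
def w2 (A : Fin 2 × Fin 2 → ZMod 2) : ℕ := if isZero4 A then 0 else if det0 A then 1 else 2
/-- Incidence weight: `0 / 1 / 3` (number of J-planes annihilated, from below). -/
def w3 (A : Fin 2 × Fin 2 → ZMod 2) : ℕ := if isZero4 A then 0 else if det0 A then 1 else 3

/-- Pointwise `2·w2 ≤ w3 + 1`. -/
theorem two_mul_w2_le (A : Fin 2 × Fin 2 → ZMod 2) : 2 * w2 A ≤ w3 A + 1 := by
  unfold w2 w3; split_ifs <;> omega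

/-- (I) incidences over `𝔽₂`: a rank-one matrix annihilates `≥ 1` J-plane, an invertible one `≥ 3`
(in fact exactly `1` and `3`; `decide` over the 16 matrices). -/
theorem w3_le_card_perp : ∀ A : Fin 2 × Fin 2 → ZMod 2, w3 A ≤ (Finset.univ.filter fun l => perp A l = true).card :=
  forall_of_forall_mk4 (by decide)

/-- Row selector of a rank-one matrix over `𝔽₂` (`1` on the nonzero rows). -/
def r1 (A : Fin 2 × Fin 2 → ZMod 2) (κ : Fin 2) : ZMod 2 := if A (κ, 0) = 0 ∧ A (κ, 1) = 0 then 0 else 1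
/-- The nonzero row of a rank-one matrix over `𝔽₂` (row 0 if nonzero, else row 1). -/
def c1 (A : Fin 2 × Fin 2 → ZMod 2) (μ : Fin 2) : ZMod 2 := if A (0, 0) = 0 ∧ A (0, 1) = 0 then A (1, μ) else A (0, μ)

/-- Over `𝔽₂` a matrix with `det = 0` is the outer product `r1 ⊗ c1` (`decide` over the 16 matrices). -/
theorem fac1 : ∀ A : Fin 2 × Fin 2 → ZMod 2, det0 A = true → ∀ κ μ, A (κ, μ) = r1 A κ * c1 A μ :=
  forall_of_forall_mk4 (by decide)

/-- A matrix passing `isZero4` vanishes. -/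
theorem fac0 : ∀ A : Fin 2 × Fin 2 → ZMod 2, isZero4 A = true → ∀ κ μ, A (κ, μ) = 0 :=
  forall_of_forall_mk4 (by decide)

/-- Every `A ∈ M₂(𝔽₂)` is a sum of `w2 A` outer products (so `w2 A` is a rank bound in the sense of
`RankOneXForms.kmn_le_sum_rankBound_X`). -/
theorem exists_fac (A : Fin 2 × Fin 2 → ZMod 2) :
    ∃ (ρ : ℕ) (r c : Fin ρ → Fin 2 → ZMod 2), ρ = w2 A ∧ ∀ κ μ, A (κ, μ) = ∑ j, r j κ * c j μ := by
  unfold w2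
  by_cases h0 : isZero4 A = true
  · exact ⟨0, Fin.elim0, Fin.elim0, by simp [h0], fun κ μ => by simp [fac0 A h0 κ μ]⟩
  · by_cases h1 : det0 A = true
    · exact ⟨1, fun _ => r1 A, fun _ => c1 A, by simp [h0, h1], fun κ μ => by simp [fac1 A h1 κ μ]⟩
    · refine ⟨2, fun j κ => if κ = j then 1 else 0, fun j μ => A (j, μ), by simp [h0, h1], fun κ μ => ?_⟩
      rw [Fin.sum_univ_two]
      fin_cases κ <;> simp

/-- **The counting**: any decomposition of `⟨2,2,n⟩` over `𝔽₂` into `r` triads has `7n ≤ 2r`. -/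
theorem seven_mul_le_two_mul_card (n r : ℕ) (w : Fin r → Fin 2 × Fin n → ZMod 2)
    (u : Fin r → Fin 2 × Fin 2 → ZMod 2) (v : Fin r → Fin 2 × Fin n → ZMod 2)
    (hdec : matMulTensor (ZMod 2) 2 2 n = ∑ i, triad (w i) (u i) (v i)) : 7 * n ≤ 2 * r := by
  classical
  -- (S) the X-ranks sum to at least `4n`
  choose ρ rr cc hρ hfac using fun i => exists_fac (u i)
  have hS : 2 * 2 * n ≤ ∑ i, ρ i :=
    RankOneXForms.kmn_le_sum_rankBound_X 2 2 n w u v hdec ρ rr cc (fun i κ μ => hfac i κ μ)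
  have hρw : ∑ i, ρ i = ∑ i, w2 (u i) := Finset.sum_congr rfl fun i _ => hρ i
  -- (J) the cap of each of the nine planes
  have hA : ∀ i x, (bilinCompOfTriads (ZMod 2) w u v hdec).f i x = dotX (u i) x := fun i x => rfl
  have hJ : ∀ l : Fin 9, 3 * n + (Finset.univ.filter fun i => perp (u i) l = true).card ≤ r := by
    intro l
    have h := (jPlane l).three_mul_add_card_le (bilinCompOfTriads (ZMod 2) w u v hdec) u hA
      (fun i => perp (u i) l = true) (fun i hi => perp_dotX hi)
    simpa only [Fintype.card_fin] using h
  have hJsum : ∑ l : Fin 9, (3 * n + (Finset.univ.filter fun i => perp (u i) l = true).card) ≤ ∑ _l : Fin 9, r :=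
    Finset.sum_le_sum fun l _ => hJ l
  rw [Finset.sum_add_distrib] at hJsum
  simp only [Finset.sum_const, Finset.card_univ, Fintype.card_fin, smul_eq_mul] at hJsum
  -- (I) double counting of incidences
  have hI : ∑ i, w3 (u i) ≤ ∑ l : Fin 9, (Finset.univ.filter fun i => perp (u i) l = true).card := by
    calc ∑ i, w3 (u i) ≤ ∑ i, (Finset.univ.filter fun l => perp (u i) l = true).card :=
          Finset.sum_le_sum fun i _ => w3_le_card_perp (u i)
      _ = ∑ l : Fin 9, (Finset.univ.filter fun i => perp (u i) l = true).card := by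
          simp only [Finset.card_filter]
          exact Finset.sum_comm
  -- (T') twice the rank weight is at most the incidence weight plus one
  have hT : 2 * ∑ i, w2 (u i) ≤ ∑ i, w3 (u i) + r := by
    have h := Finset.sum_le_sum fun i (_ : i ∈ (Finset.univ : Finset (Fin r))) => two_mul_w2_le (u i)
    rw [← Finset.mul_sum, Finset.sum_add_distrib] at h
    simpa using h
  omega

/-- **Hopcroft–Kerr 1971 over `GF(2)`, lower bound**: `7n ≤ 2·R_𝔽₂(⟨2,2,n⟩)`. -/
theorem seven_mul_le_two_mul_tensorRank_matMulTensor_22n_gf2 (n : ℕ) :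
    7 * n ≤ 2 * tensorRank (matMulTensor (ZMod 2) 2 2 n) := by
  obtain ⟨w, u, v, hdec⟩ := exists_triad_decomposition_tensorRank (matMulTensor (ZMod 2) 2 2 n)
  exact seven_mul_le_two_mul_card n _ w u v hdec

/-- **`R_𝔽₂(⟨2,2,n⟩) = ⌈7n/2⌉`** (Hopcroft–Kerr 1971): the kernel floor meets the tree's Hopcroft–Kerr
gluing scheme `hopcroftKerr1971_tensorRank_matMulTensor_22n_le`. -/
theorem tensorRank_matMulTensor_22n_gf2 (n : ℕ) :
    tensorRank (matMulTensor (ZMod 2) 2 2 n) = (7 * n + 1) / 2 := by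
  have h1 := seven_mul_le_two_mul_tensorRank_matMulTensor_22n_gf2 n
  have h2 := hopcroftKerr1971_tensorRank_matMulTensor_22n_le (K := ZMod 2) n
  omega

/-- **`R_𝔽₂(⟨2,2,5⟩) = 18`** — the census cell (HK71 / Alekseev–Nazarov 2019 printed value) as a kernel value. -/
theorem tensorRank_matMulTensor_225_gf2 : tensorRank (matMulTensor (ZMod 2) 2 2 5) = 18 :=
  tensorRank_matMulTensor_22n_gf2 5

end GF2

end Summit.MatrixMultiplication.OmegaCensus.SmallFormats
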